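import Summits.BirchSwinnertonDyer.Rank1Residual.Supersingular.KuriharaTwistRecordAssemblyBall
import Summits.BirchSwinnertonDyer.Rank1Residual.Supersingular.KuriharaTwistBirch
import HarnessLib

/-!
# Twist records assembled with their rounding certificates and an enclosure of TWISTED `L`-VALUES:
# `certL` row + `certR` row + balls around `re(Π(a_ℓ−2)·L(E,1) + Σ_{j≠0} e(−jk)·τ(χ_j)·L(f,χ̄_j,1))/(p·Ω⁺_f)`
# ⟹ `BSD(E,p)` on X6 / X7 — the enclosure hypothesis `hball` of `KuriharaTwistRecordAssemblyBall` RESTATED,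
# by the tree identity `plusPeriod_mul_binSum_eq` (Birch + DFT + Hecke), about named analytic quantities

Cell `b2b-bsdres`, supersingular family, prover A = unit `b2b-bsdres-x10b` (gen 12).  Topic file; namespace
`Summit.BirchSwinnertonDyer.Rank1Residual.Supersingular`.  THEOREMS ONLY (compositions by name); no named
fact, no definition, nothing asserted about any curve, nothing booked; X6 / X7 stay CONSTRUCTION-SHAPED.

HONEST FRAMING (run/shared/lean/b2b/bsd-rank1-residual/, verbatim): the goal of the cell is to DELETE the
COMBINATION-SHAPED residual classes of the BSD formula in analytic rank `≤ 1` from PUBLISHED theorems only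
and to TYPE the construction-shaped ones; this is not "finishing BSD".

## What this file does (X6-KURIHARA.md §13)

Gen 11 (`KuriharaTwistRecordAssemblyBall`) reduced the chain "landed twist record + rounding certificate ⟹
`BSD(E,p)`" to tree theorems modulo ONE hypothesis `hball`: for each `j < p` the engine's ball contains
`D'·c_∞·Σ_{a : m(a) = j} [a/n]⁺_f` — a statement about PLUS-SYMBOL BINS, which is not what the engine
computes.  The engine (implementation 3c/3d) evaluates `L(E,1)` and the twisted central values `L(f, χ̄_j, 1)`
by their `q`-series, the Gauss sums `τ(χ_j)`, roots of unity and `ω₁` (AGM), and forms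
`C_k = p⁻¹ Σ_j ζ^{−jk} S_j / ω₁`.  Gen 12's `KuriharaTwistBirch.plusPeriod_mul_binSum_eq` proves in the kernel
that `p·Ω⁺_f·Σ_{m(a)=k}[a/n]⁺_f = Π_{ℓ∣n}(a_ℓ−2)·L(E,1) + Σ_{j≠0} e_p(−jk)·τ(χ_j)·L_j(1)` (`L_j` any entire
continuation of `L(f, χ_j⁻¹, s)`, `χ_j = e_p(j·m(·))` the bin characters).  Hence:

* `TwistRecord.bins_eq_of_validHasse_of_LValueBall` — `hbins` (exact bins) from a `validHasse` rounding
  certificate matching the record and the hypothesis **`hballL`**: for every family `L_j` of entire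
  continuations of the `L(f, χ_j⁻¹, s)`, `j ≠ 0`, and every `k < p`, the recorded ball (centre within
  `marNum/10^marExp` of `binsStar[k]`, radius `≤ radNum/10^radExp`) contains
  `D' · c_∞ · re(Π_{ℓ∣n}(a_ℓ−2)·L(E,1) + Σ_{j≠0} e_p(−jk)·τ(χ_j)·L_j(1)) / (p·Ω⁺_f)`.
* `X6/X7.bsdp_rank{Zero,One}_of_certifiedL_of_LValueBall` — the four assembled consumers of
  `KuriharaTwistRecordAssemblyBall` with `hball` replaced by `hballL` (square-freeness / goodness of the
  level primes come from the Kolyvagin binder `hn`/`hℓ`, oddness from `5 ≤ p`).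

WHAT REMAINS OUTSIDE THE KERNEL, said plainly: the numerical enclosure of the displayed real number — i.e.
(a) `|L(E,1) − series|`, `|L(f,χ̄_j,1) − series|` ≤ the recorded tails (Hasse–Deligne `|a_m| ≤ d(m)√m`,
functional equation of the twist at the symmetric point), (b) ball evaluation of `τ(χ_j)`, `e_p(−jk)`, the
products and the real part, (c) `Ω⁺_f = c_∞·ω₁(W)` (period identification: Manin constant `1` of the
optimal curve, recorded `manin`/`optimality` fields; `ω₁` by AGM).  Birch's formula, the character
orthogonality, the Hecke relation for `S_0`, primitivity/evenness of `χ_j` and the rounding are kernel steps.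
Per pair; NOT a class theorem; nothing booked (lane + referee book pairs).

References: `KuriharaTwistRecordAssemblyBall.lean` (gen 11), `KuriharaTwistBirch{Char,}.lean` (gen 12);
C.-H. Kim, Amer. J. Math. 148 (2026) Thm. 1.9 (6) [Kim2022StructureSelmer]; Mazur–Tate–Teitelbaum, Invent.
Math. 84 (1986) §I.8 (8.6) [MazurTateTeitelbaum1986Invent]; J. E. Cremona, *Algorithms* (1997) §2.8
[CremonaAlgorithms1997].
-/

noncomputable section

open scoped Classical MatrixGroups ModularForm

open CongruenceSubgroup WeierstrassCurve Literature.NumberTheory.EllipticCurves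
  Literature.NumberTheory.EllipticCurves.ModularForms
  Literature.NumberTheory.EllipticCurves.Rank1Residual
  Literature.NumberTheory.EllipticCurves.Rank1Residual.Typed
  Summit.BirchSwinnertonDyer.Rank1Residual.Supersingular.KuriharaTwist

namespace Summit.BirchSwinnertonDyer.Rank1Residual.Supersingular

namespace KuriharaTwist

variable {N : ℕ} [NeZero N] {f : CuspForm (Gamma0 N) 2}
  {W : WeierstrassCurve ℚ} [W.IsElliptic] [W.IsGloballyMinimal]

/-- At a Kolyvagin level every prime factor is a prime of good reduction. [folklore] -/
theorem hasGoodReductionAtPrime_of_isKolyvaginProduct {p k n : ℕ} (hn : Kato.IsKolyvaginProduct W p k n) :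
    ∀ ℓ ∈ n.primeFactors, ∀ [Fact ℓ.Prime], W.HasGoodReductionAtPrime ℓ :=
  fun _ hℓ _ => hasGoodReductionAtPrime_of_not_dvd_conductorNorm W
    (hn.isKolyvaginPrime (Nat.prime_of_mem_primeFactors hℓ) (Nat.dvd_of_mem_primeFactors hℓ)).not_dvd_conductorNorm

/-- **`hbins` FROM A ROUNDING CERTIFICATE + AN ENCLOSURE OF THE TWISTED `L`-VALUE COMBINATION.**  As
`TwistRecord.bins_eq_of_validHasse_of_ball`, with the plus-symbol-bin enclosure `hball` replaced by `hballL`: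
for every family `L_j` (`j ∈ ℤ/p`, `j ≠ 0`) of entire continuations of `L(f, χ_j⁻¹, s)` and every `k < p`, the
engine's ball — centre `mid` within `marNum/10^marExp` of `binsStar[k]`, radius `rad ≤ radNum/10^radExp` —
contains `D' · c_∞ · re(Π_{ℓ∣n}(a_ℓ(E) − 2)·L(E,1) + Σ_{j≠0} e_p(−jk)·τ(χ_j)·L_j(1)) / (p · Ω⁺_f)`.  Extra
side conditions: `p ≠ 2`, `n` square-free with good prime factors, `ψ_ℓ` surjective for `ℓ ∣ n` (all supplied
by the consumers' Kolyvagin binders).  The identity `KuriharaTwistBirch.ratCast_binSum_eq_re_div` turns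
`hballL` (at the continuations given by `exists_differentiable_eq_twistedLSeries_holds`) into `hball`.
[cite: MazurTateTeitelbaum1986Invent, §I.8 (8.6)] [cite: CremonaAlgorithms1997, §2.8 (2.8.8) (PDF p. 26)] -/
theorem TwistRecord.bins_eq_of_validHasse_of_LValueBall (r : TwistRecord) {c : RoundingCert}
    (hc : c.validHasse = true) [hp : Fact r.p.Prime] [NeZero r.n]
    (hcp : c.p = r.p) (hcn : c.n = r.n) (hcden : c.den = r.den) (hcbins : c.bins = r.bins)
    (hD' : 0 < c.dstar) (hf : IsNewformOf W f) (hgood : W.HasGoodReductionAtPrime r.p)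
    (hcop : Nat.Coprime r.n N) (hp2 : r.p ≠ 2) (hsq : Squarefree r.n)
    (hgoodn : ∀ ℓ ∈ r.n.primeFactors, ∀ [Fact ℓ.Prime], W.HasGoodReductionAtPrime ℓ)
    (ψ : (ℓ : ℕ) → (ZMod ℓ)ˣ →* Multiplicative (ZMod (r.p ^ 1)))
    (hψ : ∀ ℓ ∈ r.n.primeFactors, Function.Surjective (ψ ℓ))
    (hballL : ∀ (L : ZMod (r.p ^ 1) → ℂ → ℂ), (∀ j, j ≠ 0 → Differentiable ℂ (L j)) →
      (∀ j, j ≠ 0 → ∀ s : ℂ, 2 < s.re → L j s = twistedLSeries f (binChar r.n ψ j)⁻¹ s) →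
      ∀ k < r.p, ∃ mid rad : ℝ, rad ≤ (c.radNum : ℝ) / 10 ^ c.radExp ∧
        |mid - ((c.binsStar.getD k 0 : ℤ) : ℝ)| ≤ (c.marNum : ℝ) / 10 ^ c.marExp ∧
        |(c.dstar : ℝ) * ((r.components : ℝ) *
          (((∏ ℓ ∈ r.n.primeFactors, ((W.frobeniusTrace ℓ : ℂ) - 2)) * W.entireLFunction 1 +
            ∑ j ∈ (Finset.univ : Finset (ZMod (r.p ^ 1))).erase 0,
              ZMod.stdAddChar (-(j * (k : ZMod (r.p ^ 1)))) *
                (gaussSum (binChar r.n ψ j) (ZMod.stdAddChar (N := r.n)) * L j 1)).re /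
            ((r.p ^ 1 : ℕ) * plusPeriod f))) - mid| ≤ rad) :
    ∀ j < r.p, ((r.bins.getD j 0 : ℤ) : ℚ) = (r.den : ℚ) * (r.components : ℚ) *
      ∑ a ∈ (Finset.univ : Finset (ZMod r.n)ˣ).filter (fun a =>
        (∑ ℓ ∈ r.n.primeFactors.attach, Multiplicative.toAdd
          (ψ ℓ.1 (ZMod.unitsMap (Nat.dvd_of_mem_primeFactors ℓ.2) a))).val = j),
        ratPlusSymbol f ((((a : ZMod r.n).val : ℕ) : ℚ) / (r.n : ℚ)) := by
  haveI : NeZero (r.p ^ 1) := ⟨pow_ne_zero 1 hp.out.ne_zero⟩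
  have hodd : Odd (r.p ^ 1) := (hp.out.odd_of_ne_two hp2).pow
  -- a family of entire continuations of the `L(f, χ_j⁻¹, s)`
  choose L hL using fun j : ZMod (r.p ^ 1) =>
    exists_differentiable_eq_twistedLSeries_holds f (m := r.n) (binChar r.n ψ j)⁻¹
  refine r.bins_eq_of_validHasse_of_ball hc hcp hcn hcden hcbins hD' hf hgood hcop ψ fun k hk => ?_
  obtain ⟨mid, rad, h1, h2, h3⟩ := hballL L (fun j _ => (hL j).1) (fun j _ => (hL j).2) k hk
  refine ⟨mid, rad, h1, h2, ?_⟩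
  have hkM : k < r.p ^ 1 := by rwa [pow_one]
  rw [Rat.cast_mul, Rat.cast_natCast, filter_val_eq_filter_binLogHom r.n ψ hkM,
    ratCast_binSum_eq_re_div hf hodd hsq hgoodn ψ hψ (k : ZMod (r.p ^ 1)) L (fun j _ => (hL j).1)
      (fun j _ => (hL j).2)]
  exact h3

end KuriharaTwist

variable (W : WeierstrassCurve ℚ) [W.IsElliptic] [W.IsGloballyMinimal]

/-- **X6 ∧ `r_an = 0` ∧ `p ≥ 5` ∧ `p ∤ ∏c`: `BSD(E,p)` from a LANDED twist record, its rounding certificate and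
an enclosure of the TWISTED `L`-VALUE combination** — `X6.bsdp_rankZero_of_certifiedL_of_roundingCert` with
`hball` replaced by `hballL` (`TwistRecord.bins_eq_of_validHasse_of_LValueBall`; square-freeness and goodness
of the level primes from the Kolyvagin binder `hn`, oddness from `5 ≤ p`).  Per pair; NOT a class theorem;
nothing booked. [cite: Kim2022StructureSelmer, Thm. 1.9 (6) (PDF p. 8), Cor. 1.6]
[cite: MazurTateTeitelbaum1986Invent, §I.8 (8.6)] [cite: CremonaAlgorithms1997, §2.8 (2.8.8) (PDF p. 26)] -/
theorem X6.bsdp_rankZero_of_certifiedL_of_LValueBall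
    (hKim : Kim2022_rankZero_padicValRat_sha_of_kuriharaNumber_ne_zero)
    (hϖ : realPeriodRat_eq_unit_mul_plusPeriod)
    (hGZK : rank_eq_analyticRank_of_analyticRank_le_one) (hmod : hasEntireLFunction_rat)
    {rs : List TwistRecord} (hrs : CertifiedL rs) {r : TwistRecord} (hr : r ∈ rs) [Fact r.p.Prime]
    (hνp : r.primes.length < r.p) [NeZero r.n] (hν : r.n.primeFactors.card = r.primes.length)
    {cs : List RoundingCert} (hcs : RoundingCertifiedHasse cs) {c : RoundingCert} (hc : c ∈ cs)
    (hcp : c.p = r.p) (hcn : c.n = r.n) (hcden : c.den = r.den) (hcbins : c.bins = r.bins)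
    (hD' : 0 < c.dstar)
    (hp : 5 ≤ r.p) (hX : ClassX6 W r.p) (hr0 : W.analyticRank = 0) (htam : ¬ r.p ∣ W.tamagawaProduct)
    {N : ℕ} [NeZero N] (f : CuspForm (Gamma0 N) 2) (hf : IsNewformOf W f) (hcop : Nat.Coprime r.n N)
    (hn : Kato.IsKolyvaginProduct W r.p 1 r.n)
    (hcyc : ∀ (ℓ : ℕ) [Fact ℓ.Prime], ℓ ∣ r.n →
      Nat.card {P : ((WeierstrassCurve.integralModelInt W).map
          (Int.castRingHom (ZMod ℓ))).toAffine.Point // r.p • P = 0} ≤ r.p)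
    (ψ : (ℓ : ℕ) → (ZMod ℓ)ˣ →* Multiplicative (ZMod (r.p ^ 1)))
    (hψ : ∀ ℓ ∈ r.n.primeFactors, Function.Surjective (ψ ℓ))
    (hballL : ∀ (L : ZMod (r.p ^ 1) → ℂ → ℂ), (∀ j, j ≠ 0 → Differentiable ℂ (L j)) →
      (∀ j, j ≠ 0 → ∀ s : ℂ, 2 < s.re → L j s = twistedLSeries f (binChar r.n ψ j)⁻¹ s) →
      ∀ k < r.p, ∃ mid rad : ℝ, rad ≤ (c.radNum : ℝ) / 10 ^ c.radExp ∧
        |mid - ((c.binsStar.getD k 0 : ℤ) : ℝ)| ≤ (c.marNum : ℝ) / 10 ^ c.marExp ∧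
        |(c.dstar : ℝ) * ((r.components : ℝ) *
          (((∏ ℓ ∈ r.n.primeFactors, ((W.frobeniusTrace ℓ : ℂ) - 2)) * W.entireLFunction 1 +
            ∑ j ∈ (Finset.univ : Finset (ZMod (r.p ^ 1))).erase 0,
              ZMod.stdAddChar (-(j * (k : ZMod (r.p ^ 1)))) *
                (gaussSum (binChar r.n ψ j) (ZMod.stdAddChar (N := r.n)) * L j 1)).re /
            ((r.p ^ 1 : ℕ) * plusPeriod f))) - mid| ≤ rad) :
    BSDp W r.p :=
  X6.bsdp_rankZero_of_certifiedL W hKim hϖ hGZK hmod hrs hr hνp hν hp hX hr0 htam f hf hn hcyc ψ hψ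
    (r.bins_eq_of_validHasse_of_LValueBall (hcs.validHasse_of_mem hc) hcp hcn hcden hcbins hD' hf hX.1.1 hcop
      (by omega) hn.squarefree (KuriharaTwist.hasGoodReductionAtPrime_of_isKolyvaginProduct hn) ψ hψ hballL)

/-- **X7 ∧ `r_an = 0` ∧ `p ≥ 5` ∧ surj(p) ∧ `p ∤ ∏c`: `BSD(E,p)` from a LANDED twist record, its rounding
certificate and an enclosure of the twisted `L`-value combination** (`X7.bsdp_rankZero_of_certifiedL_of_roundingCert`
with `hball ↦ hballL`).  Per pair; nothing booked. [cite: Kim2022StructureSelmer, Thm. 1.9 (6) (PDF p. 8), Cor. 1.6]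
[cite: MazurTateTeitelbaum1986Invent, §I.8 (8.6)] [cite: CremonaAlgorithms1997, §2.8 (2.8.8) (PDF p. 26)] -/
theorem X7.bsdp_rankZero_of_certifiedL_of_LValueBall
    (hKim : Kim2022_rankZero_padicValRat_sha_of_kuriharaNumber_ne_zero)
    (hϖ : realPeriodRat_eq_unit_mul_plusPeriod)
    (hGZK : rank_eq_analyticRank_of_analyticRank_le_one) (hmod : hasEntireLFunction_rat)
    {rs : List TwistRecord} (hrs : CertifiedL rs) {r : TwistRecord} (hr : r ∈ rs) [Fact r.p.Prime]
    (hνp : r.primes.length < r.p) [NeZero r.n] (hν : r.n.primeFactors.card = r.primes.length)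
    {cs : List RoundingCert} (hcs : RoundingCertifiedHasse cs) {c : RoundingCert} (hc : c ∈ cs)
    (hcp : c.p = r.p) (hcn : c.n = r.n) (hcden : c.den = r.den) (hcbins : c.bins = r.bins)
    (hD' : 0 < c.dstar)
    (hp : 5 ≤ r.p) (hX : ClassX7 W r.p) (hsurj : Surj W r.p) (hr0 : W.analyticRank = 0)
    (htam : ¬ r.p ∣ W.tamagawaProduct)
    {N : ℕ} [NeZero N] (f : CuspForm (Gamma0 N) 2) (hf : IsNewformOf W f) (hcop : Nat.Coprime r.n N)
    (hn : Kato.IsKolyvaginProduct W r.p 1 r.n)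
    (hcyc : ∀ (ℓ : ℕ) [Fact ℓ.Prime], ℓ ∣ r.n →
      Nat.card {P : ((WeierstrassCurve.integralModelInt W).map
          (Int.castRingHom (ZMod ℓ))).toAffine.Point // r.p • P = 0} ≤ r.p)
    (ψ : (ℓ : ℕ) → (ZMod ℓ)ˣ →* Multiplicative (ZMod (r.p ^ 1)))
    (hψ : ∀ ℓ ∈ r.n.primeFactors, Function.Surjective (ψ ℓ))
    (hballL : ∀ (L : ZMod (r.p ^ 1) → ℂ → ℂ), (∀ j, j ≠ 0 → Differentiable ℂ (L j)) →
      (∀ j, j ≠ 0 → ∀ s : ℂ, 2 < s.re → L j s = twistedLSeries f (binChar r.n ψ j)⁻¹ s) →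
      ∀ k < r.p, ∃ mid rad : ℝ, rad ≤ (c.radNum : ℝ) / 10 ^ c.radExp ∧
        |mid - ((c.binsStar.getD k 0 : ℤ) : ℝ)| ≤ (c.marNum : ℝ) / 10 ^ c.marExp ∧
        |(c.dstar : ℝ) * ((r.components : ℝ) *
          (((∏ ℓ ∈ r.n.primeFactors, ((W.frobeniusTrace ℓ : ℂ) - 2)) * W.entireLFunction 1 +
            ∑ j ∈ (Finset.univ : Finset (ZMod (r.p ^ 1))).erase 0,
              ZMod.stdAddChar (-(j * (k : ZMod (r.p ^ 1)))) *
                (gaussSum (binChar r.n ψ j) (ZMod.stdAddChar (N := r.n)) * L j 1)).re /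
            ((r.p ^ 1 : ℕ) * plusPeriod f))) - mid| ≤ rad) :
    BSDp W r.p :=
  X7.bsdp_rankZero_of_certifiedL W hKim hϖ hGZK hmod hrs hr hνp hν hp hX hsurj hr0 htam f hf hn hcyc ψ hψ
    (r.bins_eq_of_validHasse_of_LValueBall (hcs.validHasse_of_mem hc) hcp hcn hcden hcbins hD' hf hX.1.1 hcop
      (by omega) hn.squarefree (KuriharaTwist.hasGoodReductionAtPrime_of_isKolyvaginProduct hn) ψ hψ hballL)

/-- **X7 ∧ `r_an = 1` ∧ `p ≥ 5` ∧ surj(p), `ord_p #Ш_an = 0`: `BSD(E,p)` from a LANDED prime-level twist record,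
its rounding certificate and an enclosure of the twisted `L`-value combination**
(`X7.bsdp_rankOne_of_certifiedL_of_roundingCert` with `hball ↦ hballL`).  Per pair; nothing booked.
[cite: Kim2022StructureSelmer, Thm. 1.9 (6) (PDF p. 8), Cor. 1.6]
[cite: MazurTateTeitelbaum1986Invent, §I.8 (8.6)] [cite: CremonaAlgorithms1997, §2.8 (2.8.8) (PDF p. 26)] -/
theorem X7.bsdp_rankOne_of_certifiedL_of_LValueBall
    (hKim : Kim2022_rankOne_card_sha_eq_one_of_kuriharaNumber_ne_zero)
    (hϖ : realPeriodRat_eq_unit_mul_plusPeriod)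
    (hGZK : rank_eq_analyticRank_of_analyticRank_le_one) (hmod : hasEntireLFunction_rat)
    {rs : List TwistRecord} (hrs : CertifiedL rs) {r : TwistRecord} (hr : r ∈ rs) [Fact r.p.Prime]
    [hrn : Fact r.n.Prime] (hνp : r.primes.length < r.p) (hν : r.n.primeFactors.card = r.primes.length)
    {cs : List RoundingCert} (hcs : RoundingCertifiedHasse cs) {c : RoundingCert} (hc : c ∈ cs)
    (hcp : c.p = r.p) (hcn : c.n = r.n) (hcden : c.den = r.den) (hcbins : c.bins = r.bins)
    (hD' : 0 < c.dstar)
    (hp : 5 ≤ r.p) (hX : ClassX7 W r.p) (hsurj : Surj W r.p) (hr1 : W.analyticRank = 1)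
    {q : ℚ} (hq : shaAn W = (q : ℂ)) (hv : padicValRat r.p q = 0)
    {N : ℕ} [NeZero N] (f : CuspForm (Gamma0 N) 2) (hf : IsNewformOf W f) (hcop : Nat.Coprime r.n N)
    (hℓ : Kato.IsKolyvaginPrime W r.p 1 r.n)
    (hcyc : Nat.card {P : ((WeierstrassCurve.integralModelInt W).map
        (Int.castRingHom (ZMod r.n))).toAffine.Point // r.p • P = 0} ≤ r.p)
    (ψ : (ℓ' : ℕ) → (ZMod ℓ')ˣ →* Multiplicative (ZMod (r.p ^ 1)))
    (hψ : Function.Surjective (ψ r.n))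
    (hballL : ∀ (L : ZMod (r.p ^ 1) → ℂ → ℂ), (∀ j, j ≠ 0 → Differentiable ℂ (L j)) →
      (∀ j, j ≠ 0 → ∀ s : ℂ, 2 < s.re → L j s = twistedLSeries f (binChar r.n ψ j)⁻¹ s) →
      ∀ k < r.p, ∃ mid rad : ℝ, rad ≤ (c.radNum : ℝ) / 10 ^ c.radExp ∧
        |mid - ((c.binsStar.getD k 0 : ℤ) : ℝ)| ≤ (c.marNum : ℝ) / 10 ^ c.marExp ∧
        |(c.dstar : ℝ) * ((r.components : ℝ) *
          (((∏ ℓ ∈ r.n.primeFactors, ((W.frobeniusTrace ℓ : ℂ) - 2)) * W.entireLFunction 1 +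
            ∑ j ∈ (Finset.univ : Finset (ZMod (r.p ^ 1))).erase 0,
              ZMod.stdAddChar (-(j * (k : ZMod (r.p ^ 1)))) *
                (gaussSum (binChar r.n ψ j) (ZMod.stdAddChar (N := r.n)) * L j 1)).re /
            ((r.p ^ 1 : ℕ) * plusPeriod f))) - mid| ≤ rad) :
    BSDp W r.p :=
  haveI : NeZero r.n := ⟨hrn.out.ne_zero⟩
  X7.bsdp_rankOne_of_certifiedL W hKim hϖ hGZK hmod hrs hr hνp hν hp hX hsurj hr1 hq hv f hf hℓ hcyc ψ hψ
    (r.bins_eq_of_validHasse_of_LValueBall (hcs.validHasse_of_mem hc) hcp hcn hcden hcbins hD' hf hX.1.1 hcop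
      (by omega) hℓ.isKolyvaginProduct.squarefree
      (KuriharaTwist.hasGoodReductionAtPrime_of_isKolyvaginProduct hℓ.isKolyvaginProduct) ψ
      (fun ℓ hℓ' => by
        rw [hrn.out.primeFactors, Finset.mem_singleton] at hℓ'
        subst hℓ'
        exact hψ)
      hballL)

/-- **X6 ∧ `r_an = 1` ∧ `p ≥ 5`, `ord_p #Ш_an = 0`: `BSD(E,p)` from a LANDED prime-level twist record, its
rounding certificate and an enclosure of the twisted `L`-value combination**
(`X6.bsdp_rankOne_of_certifiedL_of_roundingCert` with `hball ↦ hballL`).  Per pair; nothing booked.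
[cite: Kim2022StructureSelmer, Thm. 1.9 (6) (PDF p. 8), Cor. 1.6]
[cite: MazurTateTeitelbaum1986Invent, §I.8 (8.6)] [cite: CremonaAlgorithms1997, §2.8 (2.8.8) (PDF p. 26)] -/
theorem X6.bsdp_rankOne_of_certifiedL_of_LValueBall
    (hKim : Kim2022_rankOne_card_sha_eq_one_of_kuriharaNumber_ne_zero)
    (hϖ : realPeriodRat_eq_unit_mul_plusPeriod)
    (hGZK : rank_eq_analyticRank_of_analyticRank_le_one) (hmod : hasEntireLFunction_rat)
    {rs : List TwistRecord} (hrs : CertifiedL rs) {r : TwistRecord} (hr : r ∈ rs) [Fact r.p.Prime]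
    [hrn : Fact r.n.Prime] (hνp : r.primes.length < r.p) (hν : r.n.primeFactors.card = r.primes.length)
    {cs : List RoundingCert} (hcs : RoundingCertifiedHasse cs) {c : RoundingCert} (hc : c ∈ cs)
    (hcp : c.p = r.p) (hcn : c.n = r.n) (hcden : c.den = r.den) (hcbins : c.bins = r.bins)
    (hD' : 0 < c.dstar)
    (hp : 5 ≤ r.p) (hX : ClassX6 W r.p) (hr1 : W.analyticRank = 1)
    {q : ℚ} (hq : shaAn W = (q : ℂ)) (hv : padicValRat r.p q = 0)
    {N : ℕ} [NeZero N] (f : CuspForm (Gamma0 N) 2) (hf : IsNewformOf W f) (hcop : Nat.Coprime r.n N)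
    (hℓ : Kato.IsKolyvaginPrime W r.p 1 r.n)
    (hcyc : Nat.card {P : ((WeierstrassCurve.integralModelInt W).map
        (Int.castRingHom (ZMod r.n))).toAffine.Point // r.p • P = 0} ≤ r.p)
    (ψ : (ℓ' : ℕ) → (ZMod ℓ')ˣ →* Multiplicative (ZMod (r.p ^ 1)))
    (hψ : Function.Surjective (ψ r.n))
    (hballL : ∀ (L : ZMod (r.p ^ 1) → ℂ → ℂ), (∀ j, j ≠ 0 → Differentiable ℂ (L j)) →
      (∀ j, j ≠ 0 → ∀ s : ℂ, 2 < s.re → L j s = twistedLSeries f (binChar r.n ψ j)⁻¹ s) →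
      ∀ k < r.p, ∃ mid rad : ℝ, rad ≤ (c.radNum : ℝ) / 10 ^ c.radExp ∧
        |mid - ((c.binsStar.getD k 0 : ℤ) : ℝ)| ≤ (c.marNum : ℝ) / 10 ^ c.marExp ∧
        |(c.dstar : ℝ) * ((r.components : ℝ) *
          (((∏ ℓ ∈ r.n.primeFactors, ((W.frobeniusTrace ℓ : ℂ) - 2)) * W.entireLFunction 1 +
            ∑ j ∈ (Finset.univ : Finset (ZMod (r.p ^ 1))).erase 0,
              ZMod.stdAddChar (-(j * (k : ZMod (r.p ^ 1)))) *
                (gaussSum (binChar r.n ψ j) (ZMod.stdAddChar (N := r.n)) * L j 1)).re /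
            ((r.p ^ 1 : ℕ) * plusPeriod f))) - mid| ≤ rad) :
    BSDp W r.p :=
  haveI : NeZero r.n := ⟨hrn.out.ne_zero⟩
  X6.bsdp_rankOne_of_certifiedL W hKim hϖ hGZK hmod hrs hr hνp hν hp hX hr1 hq hv f hf hℓ hcyc ψ hψ
    (r.bins_eq_of_validHasse_of_LValueBall (hcs.validHasse_of_mem hc) hcp hcn hcden hcbins hD' hf hX.1.1 hcop
      (by omega) hℓ.isKolyvaginProduct.squarefree
      (KuriharaTwist.hasGoodReductionAtPrime_of_isKolyvaginProduct hℓ.isKolyvaginProduct) ψ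
      (fun ℓ hℓ' => by
        rw [hrn.out.primeFactors, Finset.mem_singleton] at hℓ'
        subst hℓ'
        exact hψ)
      hballL)

end Summit.BirchSwinnertonDyer.Rank1Residual.Supersingular

end
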